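import Summits.CriticalPhenomena.PercolationContinuityZ3.Theorems.PercNearOneGluingNoHeavyLowerTailSahiE3JuntaMeetBlock
import Mathlib.Tactic.Linarith
import Mathlib.Tactic.Ring
import HarnessLib

/-!
# `NoHeavyLowerTail` (crux stmt-CriticalPhenomena-4575), Sahi programme P4: Sahi's `E₃ ≥ 0` whenever `A ∩ B` depends only on a
# block on which the top section of `A` is a cylinder — unconditionally, in every dimension

Support file (cell `prim-l12`, seat P4, generation 3; `--supports stmt-CriticalPhenomena-4575`).  No named facts, no sorries, no
definitions.  An unconditional instance of the transfer theorem `SahiE3JuntaMeet.sahiE3_nonneg_of_mul_junta_of_block`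
("Sahi's inequality is local in the intersection", `…SahiE3JuntaMeetBlock`): the block hypothesis — Sahi's inequality on the block
for the top-fibre pair `(A*, B*)` against every up-set `T` — is discharged by the CYLINDER-SLOT theorem of the factory seat gen-8
(`sahiE3_cylinder_nonneg`, `…SahiE3Cylinder`: `E₃ ≥ 0` when one of the three functions is a cylinder indicator) whenever the top
section `A* = {T ⊆ W : D ∪ T ∈ A}` is a cylinder `{T : a ⊆ T}` of the block `W = a ∪ W'`.

**`sahiE3_nonneg_of_mul_junta_of_cylinderSection`** — on the weighted cube `(a ∪ W') ∪ D` (pairwise disjoint, `p ∈ [0,1]`), for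
monotone `{0,1}`-valued `u, f, g` (up-sets `U, A, B`) with `f·g` determined by the block `a ∪ W'` and `f(D ∪ T) = 1[a ⊆ T]` for
`T ⊆ a ∪ W'`:  `E₃(u, f, g) ≥ 0`.  Example (five coordinates, `a = {1}`, `W' = {2,3}`, `D = {4,5}`):
`A = X₁ ∧ (X₂ ∨ X₃ ∨ X₄)`, `B = (X₂ ∨ X₃) ∧ (X₁ ∨ X₅)`, `A ∩ B = X₁(X₂ ∨ X₃)` (not principal, no principal slot, `U` arbitrary).
Together with `…SahiE3PrincipalMeet` (`A ∩ B` principal) and `…SahiE3JuntaMeetSmall` (`A ∩ B` a `≤ 3`-junta) these are the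
unconditional classes of Kahn's Conjecture 5 obtained from the locality principle so far.  [this work]
-/

noncomputable section

namespace Summit.CriticalPhenomena.PercolationContinuityZ3.Theorems

namespace SahiE3JuntaMeet

open Finset Literature.Probability.Percolation Literature.Probability.Percolation.DecisionTree SahiE3PrincipalMeet

variable {ι : Type*} [DecidableEq ι]

/-- **Sahi's `E₃ ≥ 0` when `A ∩ B` is determined by a block on which the top section of `A` is a cylinder.**  On the weighted cube
`(a ∪ W') ∪ D` (`a, W', D` pairwise disjoint, `p ∈ [0,1]`), let `u, f, g` be monotone `{0,1}`-valued with
`f(Z ∪ T)·g(Z ∪ T) = f(D ∪ T)·g(D ∪ T)` (`Z ⊆ D`, `T ⊆ a ∪ W'`) and `f(D ∪ T) = 1[a ⊆ T]` (`T ⊆ a ∪ W'`).  Then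
`2E[ufg] + Eu·Ef·Eg − Eu·E[fg] − Ef·E[ug] − Eg·E[uf] ≥ 0`.  [this work; `sahiE3_nonneg_of_mul_junta_of_block` +
`sahiE3_cylinder_nonneg`] -/
theorem sahiE3_nonneg_of_mul_junta_of_cylinderSection (a W' D : Finset ι) (haW : Disjoint a W')
    (hWD : Disjoint (a ∪ W') D) {p : ι → ℝ} (hp0 : ∀ i, 0 ≤ p i) (hp1 : ∀ i, p i ≤ 1) {u f g : Finset ι → ℝ}
    (hu : ∀ ⦃S T : Finset ι⦄, S ⊆ T → u S ≤ u T) (hu01 : ∀ S, u S = 0 ∨ u S = 1)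
    (hf : ∀ ⦃S T : Finset ι⦄, S ⊆ T → f S ≤ f T) (hf01 : ∀ S, f S = 0 ∨ f S = 1)
    (hg : ∀ ⦃S T : Finset ι⦄, S ⊆ T → g S ≤ g T) (hg01 : ∀ S, g S = 0 ∨ g S = 1)
    (hfg : ∀ Z, Z ⊆ D → ∀ T, T ⊆ a ∪ W' → f (Z ∪ T) * g (Z ∪ T) = f (D ∪ T) * g (D ∪ T))
    (hfa : ∀ T, T ⊆ a ∪ W' → f (D ∪ T) = if a ⊆ T then 1 else 0) :
    0 ≤ 2 * ED ((a ∪ W') ∪ D) p (fun S => u S * f S * g S)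
          + ED ((a ∪ W') ∪ D) p u * ED ((a ∪ W') ∪ D) p f * ED ((a ∪ W') ∪ D) p g
          - ED ((a ∪ W') ∪ D) p u * ED ((a ∪ W') ∪ D) p (fun S => f S * g S)
          - ED ((a ∪ W') ∪ D) p f * ED ((a ∪ W') ∪ D) p (fun S => u S * g S)
          - ED ((a ∪ W') ∪ D) p g * ED ((a ∪ W') ∪ D) p (fun S => u S * f S) := by
  have hg0 : ∀ S, 0 ≤ g S := fun S => by rcases hg01 S with h | h <;> norm_num [h]
  have hgs : ∀ ⦃S T : Finset ι⦄, S ⊆ T → g (D ∪ S) ≤ g (D ∪ T) :=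
    fun S T hST => hg (Finset.union_subset_union (Finset.Subset.refl D) hST)
  refine sahiE3_nonneg_of_mul_junta_of_block (a ∪ W') D hWD hp0 hp1 hu hu01 hf hf01 hg hg01 hfg ?_
  intro t ht ht01
  have ht0 : ∀ S, 0 ≤ t S := fun S => by rcases ht01 S with h | h <;> norm_num [h]
  -- the cylinder-slot theorem on the block `a ∪ W'` for the triple `(1[a ⊆ ·], t, g(D ∪ ·))`
  have h := sahiE3_cylinder_nonneg a W' haW hp0 hp1 (f := t) (g := fun S => g (D ∪ S)) ht hgs ht0 (fun S => hg0 _)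
  -- replace the cylinder indicator by the top section of `f`
  have e1 : ED (a ∪ W') p (fun S => (if a ⊆ S then (1 : ℝ) else 0) * t S * g (D ∪ S))
      = ED (a ∪ W') p (fun S => t S * f (D ∪ S) * g (D ∪ S)) :=
    ED_congr_sub _ _ fun S hS => by rw [hfa S hS]; ring
  have e2 : ED (a ∪ W') p (fun S => if a ⊆ S then (1 : ℝ) else 0) = ED (a ∪ W') p (fun S => f (D ∪ S)) :=
    ED_congr_sub _ _ fun S hS => by rw [hfa S hS]
  have e3 : ED (a ∪ W') p (fun S => (if a ⊆ S then (1 : ℝ) else 0) * g (D ∪ S))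
      = ED (a ∪ W') p (fun S => f (D ∪ S) * g (D ∪ S)) :=
    ED_congr_sub _ _ fun S hS => by rw [hfa S hS]
  have e4 : ED (a ∪ W') p (fun S => (if a ⊆ S then (1 : ℝ) else 0) * t S)
      = ED (a ∪ W') p (fun S => t S * f (D ∪ S)) :=
    ED_congr_sub _ _ fun S hS => by rw [hfa S hS]; ring
  rw [e1, e2, e3, e4] at h
  linarith

end SahiE3JuntaMeet

end Summit.CriticalPhenomena.PercolationContinuityZ3.Theorems

end
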